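import Mathlib.Analysis.InnerProductSpace.PiL2
import Mathlib.Algebra.Order.Chebyshev
import Mathlib.Data.Set.Finite.List
import Literature.Computability.Cryptography.QuantumCircuitProofs
import Literature.Computability.Cryptography.OracleKickback
import Literature.Computability.Cryptography.QubitRegisterCliffordTProofs
import HarnessLib

/-!
# The BBBV hybrid argument for oracle quantum circuits (Bennett–Bernstein–Brassard–Vazirani 1997, Thm. 3.3 / Cor. 3.4; Fortnow–Rogers 1999, Thm. 4.3)

Topic `Computability/QuantumComplexity` (family `quantum-advantage`). This file PROVES, in the
tree's model of oracle quantum computation (Q2: circuits `QCircuit G N` over a gate set `G` with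
XOR-query oracle gates `QGate.oracle k e`, semantics `QCircuit.toMatrix A` relative to an oracle
language `A`; families `QCircuitFamily`, `acceptProbOn`, as used by `BQPRel`), the hybrid
argument of Bennett–Bernstein–Brassard–Vazirani bounding the effect of changing the oracle on
rarely queried strings, in the form used by Fortnow–Rogers (Thm. 4.3, "due to BBBV") in the proof
of their Thm. 4.2 (`P^C = BQP^C ≠ UP^C ∩ coUP^C` for an oracle `C`; tree fact
`Literature.Barriers.QuantumAdvantage.fortnowRogers1999_thm42`, whose proof architecture is recorded in
`Literature/Barriers/QuantumAdvantage/SupremacyTheoremsNonRelativizingProofs.lean`).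

**The printed statements** (held arXiv copies).
* BBBV, SIAM J. Comput. 26 (1997), arXiv:quant-ph/9701001, §3.1. Def. 3.2: the *query magnitude*
  `q_y(|φ_i⟩)` of `y` in the time-`i` superposition is the sum of squared magnitudes of the
  configurations querying `y`. Thm. 3.3: if the answers on a set `F` of time–string pairs with
  `∑_{(i,y) ∈ F} q_y(|φ_i⟩) ≤ ε²/T` are modified then `‖ |φ_T⟩ − |φ'_T⟩ ‖ ≤ ε`. Cor. 3.4: for every
  `ε > 0` there is `S`, `|S| ≤ 2T²/ε²`, with `‖ |φ_T⟩ − |φ_T^{(y)}⟩ ‖ ≤ ε` for all `y ∉ S`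
  (`A_y` any oracle agreeing with `A` off `y`). Thm. 3.1 (from Bernstein–Vazirani): unit vectors
  within Euclidean distance `ε` give outcome distributions within total variation `4ε`.
* Fortnow–Rogers, JCSS 59 (1999), arXiv:cs/9811023, Thm. 4.3 (BBBV): "Let `M` be an oracle BQP
  machine that runs in time `p(n)` and let `O` be an oracle and `x` an `n`-bit input. There is a
  set `S` such that for all oracles `O'`, if `O'` differs from `O` only on a single string and that
  string is not in `S` then `|P[M^{O'} accepts x] − P[M^{O} accepts x]| ≤ ε`, where
  `|S| ≤ 4p²(n)/ε²`."

**What is proved here** (all `theorem`s, no named facts).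
* `queryWeight D e ψ` — the query magnitude of a set `D` of strings at a placed oracle gate
  (Def. 3.2); `normSq_oracleGate_sub_mulVec_le` — one modified XOR query costs
  `‖(U_B − U_A)ψ‖₂² ≤ 4 q_D(ψ)` when `A`, `B` agree outside `D`;
* `queryWeights A D gs ψ` — the list of query magnitudes along a run; `l2Norm_toMatrix_sub_le` —
  the hybrid (telescoping + unitarity) bound `‖U^B_C ψ − U^A_C ψ‖₂ ≤ ∑_t 2√(q_D(|φ_t⟩))`
  (Thm. 3.3), `sum_map_two_mul_sqrt_le` (Cauchy–Schwarz), `sum_sum_queryWeights_le` (total query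
  magnitude `≤ T`);
* `exists_finset_l2Norm_runOn_sub_le` — Cor. 3.4 in state-vector form with `|S| ≤ 4T²/ε²`, `T`
  the number of oracle gates;
* `abs_sum_normSq_sub_le` (Thm. 3.1 for one event, sharp constant `1`),
  `QCircuit.abs_acceptProb_sub_le`;
* `QCircuitFamily.exists_finset_abs_acceptProbOn_sub_le` (unitary gate sets) and
  `fortnowRogers1999_thm43` (Clifford+T, the gate set of `BQPRel`): Fortnow–Rogers' Thm. 4.3
  verbatim, with `p(n)` the number of oracle gates of the circuit run on `x`.

## Design notes

* The plain function type `QReg N → ℂ` carries the sup norm, so the Euclidean norm is taken in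
  `EuclideanSpace ℂ (QReg N)` (`l2Norm`, `l2Norm_eq_sqrt_normSq` links it to the tree's `normSq`).
* Constants: for the XOR query `|q,b⟩ ↦ |q, b ⊕ A(q)⟩` the one-step error has squared norm at most
  `4 q_D` (not `q_D` as for BBBV's query-tape machines), whence `S = {y : ∑_t q_y ≥ ε²/4T}` and
  `|S| ≤ 4T²/ε²` — exactly Fortnow–Rogers' constant — together with the sharp one-event form of
  Thm. 3.1 (`|P − P'| ≤ ‖φ − φ'‖₂`, via "an event carries at most half of a zero-sum signed
  measure"), instead of BBBV's `2T²/ε²` for the Euclidean distance followed by the factor `4` of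
  Thm. 3.1.
* "`O'` differs from `O` only on a single string `y`" is rendered as
  `∀ w, w ≠ y → (w ∈ A ↔ w ∈ B)`; the general lemmas allow any set `D` of modified strings
  (`∀ w ∉ D, (w ∈ A ↔ w ∈ B)`), as in Thm. 3.3.

## Sources

* [BennettBernsteinBrassardVazirani1997] C. H. Bennett, E. Bernstein, G. Brassard, U. Vazirani,
  *Strengths and weaknesses of quantum computing*, SIAM J. Comput. 26 (1997) 1510–1523; read via
  `lit read arxiv:quant-ph/9701001`, pp. 7–8 (Thm. 3.1, Def. 3.2, Thm. 3.3 with proof, Cor. 3.4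
  with proof).
* [FortnowRogers1999JCSS] L. Fortnow, J. Rogers, *Complexity limitations on quantum computation*,
  JCSS 59 (1999) 240–252; read via `lit read arxiv:cs/9811023`, p. 7 (Thm. 4.3 and its use in the
  proof of Thm. 4.2).
* [NielsenChuang2010] §2.1.6 (unitaries preserve norms), §6.1.1 (the XOR oracle), as used in
  `QuantumCircuitProofs.lean` and `OracleKickback.lean`.
-/

noncomputable section

namespace Literature.Computability.QuantumComplexity

open Matrix

variable {G : Cryptography.QGateSet} {N k : ℕ}

/-! ### The `ℓ²`-norm of a state vector -/

/-- The `ℓ²`-norm `‖ψ‖₂ = (∑ₓ |ψ x|²)^{1/2}` of a state vector, i.e. its norm in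
`EuclideanSpace ℂ (QReg N)` (the plain function type carries the sup norm). [folklore] -/
def l2Norm (ψ : Cryptography.QReg N → ℂ) : ℝ :=
  ‖(WithLp.toLp 2 ψ : EuclideanSpace ℂ (Cryptography.QReg N))‖

/-- `‖ψ‖₂ = √(normSq ψ)`. [folklore] -/
theorem l2Norm_eq_sqrt_normSq (ψ : Cryptography.QReg N → ℂ) : l2Norm ψ = Real.sqrt (Cryptography.normSq ψ) := by
  rw [l2Norm, EuclideanSpace.norm_eq]
  rfl

/-- `‖ψ‖₂² = normSq ψ`. [folklore] -/
theorem l2Norm_sq (ψ : Cryptography.QReg N → ℂ) : l2Norm ψ ^ 2 = Cryptography.normSq ψ := by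
  rw [l2Norm_eq_sqrt_normSq, Real.sq_sqrt]
  exact Finset.sum_nonneg fun _ _ => by positivity

/-- `normSq` is nonnegative. [folklore] -/
theorem normSq_nonneg (ψ : Cryptography.QReg N → ℂ) : 0 ≤ Cryptography.normSq ψ :=
  Finset.sum_nonneg fun _ _ => by positivity

/-- `‖ψ‖₂ ≥ 0`. [folklore] -/
theorem l2Norm_nonneg (ψ : Cryptography.QReg N → ℂ) : 0 ≤ l2Norm ψ :=
  norm_nonneg _

/-- Triangle inequality for `‖·‖₂` through an intermediate point. [folklore] -/
theorem l2Norm_sub_le (a b c : Cryptography.QReg N → ℂ) : l2Norm (a - c) ≤ l2Norm (a - b) + l2Norm (b - c) := by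
  simp only [l2Norm, WithLp.toLp_sub]
  exact norm_sub_le_norm_sub_add_norm_sub _ _ _

/-- Triangle inequality for `‖·‖₂`. [folklore] -/
theorem l2Norm_add_le (a b : Cryptography.QReg N → ℂ) : l2Norm (a + b) ≤ l2Norm a + l2Norm b := by
  simp only [l2Norm, WithLp.toLp_add]
  exact norm_add_le _ _

/-- `‖0‖₂ = 0`. [folklore] -/
@[simp] theorem l2Norm_zero : l2Norm (0 : Cryptography.QReg N → ℂ) = 0 := by
  simp [l2Norm]

/-- `‖-a‖₂ = ‖a‖₂`. [folklore] -/
theorem l2Norm_neg (a : Cryptography.QReg N → ℂ) : l2Norm (-a) = l2Norm a := by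
  simp only [l2Norm, WithLp.toLp_neg, norm_neg]

/-- `‖a - b‖₂ = ‖b - a‖₂`. [folklore] -/
theorem l2Norm_sub_comm (a b : Cryptography.QReg N → ℂ) : l2Norm (a - b) = l2Norm (b - a) := by
  rw [← l2Norm_neg, neg_sub]

/-- Unitaries preserve the `ℓ²`-norm. [cite: NielsenChuang2010, §2.1.6] -/
theorem l2Norm_mulVec_of_mem_unitaryGroup {U : Matrix (Cryptography.QReg N) (Cryptography.QReg N) ℂ}
    (hU : U ∈ Matrix.unitaryGroup (Cryptography.QReg N) ℂ) (ψ : Cryptography.QReg N → ℂ) :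
    l2Norm (U *ᵥ ψ) = l2Norm ψ := by
  rw [l2Norm_eq_sqrt_normSq, l2Norm_eq_sqrt_normSq, Cryptography.normSq_mulVec_of_mem_unitaryGroup hU]

/-- `‖ψ‖₂ ≤ c` from `normSq ψ ≤ c²` (`c ≥ 0`). [folklore] -/
theorem l2Norm_le_of_normSq_le {ψ : Cryptography.QReg N → ℂ} {c : ℝ} (hc : 0 ≤ c) (h : Cryptography.normSq ψ ≤ c ^ 2) :
    l2Norm ψ ≤ c := by
  rw [l2Norm_eq_sqrt_normSq]
  exact Real.sqrt_le_iff.2 ⟨hc, h⟩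

/-! ### One oracle gate: the error caused by changing the oracle (BBBV 1997, proof of Thm. 3.3) -/

/-- **Query magnitude** of a set of strings `D` at a placed oracle gate with wires `e` in the
state `ψ`: the total squared amplitude `∑ {|ψ x|² : queryOf e x ∈ D}` of the basis states whose
query register spells a string of `D` (BBBV's `q_y(|φ_i⟩)` for `D = {y}`).
[cite: BennettBernsteinBrassardVazirani1997, Def. 3.2] -/
def queryWeight (D : Set (List Bool)) (e : Fin (k + 1) ↪ Fin N) (ψ : Cryptography.QReg N → ℂ) : ℝ :=
  open scoped Classical in ∑ x : Cryptography.QReg N, if Cryptography.queryOf e x ∈ D then ‖ψ x‖ ^ 2 else 0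

/-- Query magnitudes are nonnegative. [folklore] -/
theorem queryWeight_nonneg (D : Set (List Bool)) (e : Fin (k + 1) ↪ Fin N) (ψ : Cryptography.QReg N → ℂ) :
    0 ≤ queryWeight D e ψ := by
  classical
  exact Finset.sum_nonneg fun x _ => by
    split_ifs <;> positivity

/-- The query magnitude of `D` is at most `normSq ψ`. [cite: BennettBernsteinBrassardVazirani1997, proof of Cor. 3.4] -/
theorem queryWeight_le_normSq (D : Set (List Bool)) (e : Fin (k + 1) ↪ Fin N) (ψ : Cryptography.QReg N → ℂ) :
    queryWeight D e ψ ≤ Cryptography.normSq ψ := by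
  classical
  unfold queryWeight Cryptography.normSq
  refine Finset.sum_le_sum fun x _ => ?_
  split_ifs
  · exact le_rfl
  · positivity

/-- The oracle gate does not change the query register: `queryOf e (oracleTarget A e x) = queryOf e x`.
[folklore] -/
theorem queryOf_oracleTarget (A : Language Bool) (e : Fin (k + 1) ↪ Fin N) (x : Cryptography.QReg N) :
    Cryptography.queryOf e (Cryptography.oracleTarget A e x) = Cryptography.queryOf e x := by
  unfold Cryptography.queryOf
  exact List.ofFn_inj.2 (funext fun i => Cryptography.oracleTarget_apply_castSucc A e x i)

/-- If two oracles agree on the query string of `x`, the oracle gate sends `x` to the same basis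
state. [folklore] -/
theorem oracleTarget_eq_of_iff {A B : Language Bool} (e : Fin (k + 1) ↪ Fin N) {x : Cryptography.QReg N}
    (h : Cryptography.queryOf e x ∈ A ↔ Cryptography.queryOf e x ∈ B) : Cryptography.oracleTarget B e x = Cryptography.oracleTarget A e x := by
  have hind : B.boolIndicator (Cryptography.queryOf e x) = A.boolIndicator (Cryptography.queryOf e x) := by
    by_cases hq : Cryptography.queryOf e x ∈ A
    · rw [(Set.mem_iff_boolIndicator _ _).1 hq, (Set.mem_iff_boolIndicator _ _).1 (h.1 hq)]
    · rw [(Set.notMem_iff_boolIndicator _ _).1 hq,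
        (Set.notMem_iff_boolIndicator _ _).1 (fun hB => hq (h.2 hB))]
  unfold Cryptography.oracleTarget
  rw [hind]

/-- `‖a - b‖² ≤ 2‖a‖² + 2‖b‖²`. [folklore] -/
theorem norm_sub_sq_le_two_mul (a b : ℂ) : ‖a - b‖ ^ 2 ≤ 2 * ‖a‖ ^ 2 + 2 * ‖b‖ ^ 2 := by
  have h1 : ‖a - b‖ ≤ ‖a‖ + ‖b‖ := norm_sub_le a b
  have h2 : ‖a - b‖ ^ 2 ≤ (‖a‖ + ‖b‖) ^ 2 := pow_le_pow_left₀ (norm_nonneg _) h1 2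
  nlinarith [sq_nonneg (‖a‖ - ‖b‖)]

/-- Reindexing a query-register sum along the oracle permutation: `x ↦ oracleTarget A e x` is an
involution preserving `queryOf e`. [folklore] -/
theorem sum_ite_queryOf_oracleTarget (A : Language Bool) (D : Set (List Bool))
    [DecidablePred (· ∈ D)] (e : Fin (k + 1) ↪ Fin N) (ψ : Cryptography.QReg N → ℂ) :
    (∑ x : Cryptography.QReg N, if Cryptography.queryOf e x ∈ D then ‖ψ (Cryptography.oracleTarget A e x)‖ ^ 2 else 0) =
      ∑ x : Cryptography.QReg N, if Cryptography.queryOf e x ∈ D then ‖ψ x‖ ^ 2 else 0 := by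
  have hinv : Function.Involutive (Cryptography.oracleTarget A e (N := N)) := Cryptography.oracleTarget_oracleTarget A e
  calc (∑ x : Cryptography.QReg N, if Cryptography.queryOf e x ∈ D then ‖ψ (Cryptography.oracleTarget A e x)‖ ^ 2 else 0)
      = ∑ x : Cryptography.QReg N, (fun y => if Cryptography.queryOf e y ∈ D then ‖ψ y‖ ^ 2 else 0) (hinv.toPerm _ x) :=
        Finset.sum_congr rfl fun x _ => by
          simp only [Function.Involutive.coe_toPerm, queryOf_oracleTarget]
    _ = ∑ x : Cryptography.QReg N, if Cryptography.queryOf e x ∈ D then ‖ψ x‖ ^ 2 else 0 :=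
        Equiv.sum_comp (hinv.toPerm _) (fun y => if Cryptography.queryOf e y ∈ D then ‖ψ y‖ ^ 2 else 0)

/-- **The error of one modified query** (BBBV 1997, proof of Thm. 3.3: `|E_i⟩ = U_i|φ_i⟩ − U|φ_i⟩`
has squared magnitude controlled by the query magnitude of the modified strings). If the oracles
`A`, `B` agree outside `D`, then for the XOR query gate
`‖(U_B − U_A) ψ‖₂² ≤ 4 · q_D(ψ)`. (The constant `4` is forced by the XOR query: on the two basis
states `|q, 0⟩`, `|q, 1⟩` with `q ∈ D` the difference `U_B − U_A` acts as `±(|q,1⟩ − |q,0⟩)(⟨q,0| − ⟨q,1|)`,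
of operator norm `2`.) [cite: BennettBernsteinBrassardVazirani1997, Thm. 3.3 (proof)] -/
theorem normSq_oracleGate_sub_mulVec_le {A B : Language Bool} {D : Set (List Bool)}
    (hAB : ∀ w, w ∉ D → (w ∈ A ↔ w ∈ B)) (e : Fin (k + 1) ↪ Fin N) (ψ : Cryptography.QReg N → ℂ) :
    Cryptography.normSq ((Cryptography.placeGate e (Cryptography.oracleGate B k) - Cryptography.placeGate e (Cryptography.oracleGate A k)) *ᵥ ψ) ≤
      4 * queryWeight D e ψ := by
  classical
  have hpt : ∀ x, ((Cryptography.placeGate e (Cryptography.oracleGate B k) - Cryptography.placeGate e (Cryptography.oracleGate A k)) *ᵥ ψ) x =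
      ψ (Cryptography.oracleTarget B e x) - ψ (Cryptography.oracleTarget A e x) := fun x => by
    rw [Matrix.sub_mulVec, Pi.sub_apply, Cryptography.placeGate_oracleGate_mulVec_apply,
      Cryptography.placeGate_oracleGate_mulVec_apply]
  unfold Cryptography.normSq
  calc ∑ x, ‖((Cryptography.placeGate e (Cryptography.oracleGate B k) - Cryptography.placeGate e (Cryptography.oracleGate A k)) *ᵥ ψ) x‖ ^ 2
      = ∑ x, ‖ψ (Cryptography.oracleTarget B e x) - ψ (Cryptography.oracleTarget A e x)‖ ^ 2 :=
        Finset.sum_congr rfl fun x _ => by rw [hpt]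
    _ ≤ ∑ x, ((if Cryptography.queryOf e x ∈ D then 2 * ‖ψ (Cryptography.oracleTarget B e x)‖ ^ 2 else 0) +
          (if Cryptography.queryOf e x ∈ D then 2 * ‖ψ (Cryptography.oracleTarget A e x)‖ ^ 2 else 0)) :=
        Finset.sum_le_sum fun x _ => by
          by_cases hx : Cryptography.queryOf e x ∈ D
          · rw [if_pos hx, if_pos hx]
            exact norm_sub_sq_le_two_mul _ _
          · rw [if_neg hx, if_neg hx, oracleTarget_eq_of_iff e (hAB _ hx), sub_self]
            simp
    _ = 2 * (∑ x : Cryptography.QReg N, if Cryptography.queryOf e x ∈ D then ‖ψ (Cryptography.oracleTarget B e x)‖ ^ 2 else 0) +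
          2 * ∑ x : Cryptography.QReg N, if Cryptography.queryOf e x ∈ D then ‖ψ (Cryptography.oracleTarget A e x)‖ ^ 2 else 0 := by
        rw [Finset.sum_add_distrib, Finset.mul_sum, Finset.mul_sum]
        congr 1 <;> exact Finset.sum_congr rfl fun x _ => by split_ifs <;> simp
    _ = 4 * queryWeight D e ψ := by
        rw [sum_ite_queryOf_oracleTarget, sum_ite_queryOf_oracleTarget]
        unfold queryWeight
        ring

/-! ### The hybrid argument along a circuit (BBBV 1997, Thm. 3.3) -/

/-- The query magnitudes contributed by one gate: none for a gate symbol, `[q_D(ψ)]` for an oracle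
gate. [cite: BennettBernsteinBrassardVazirani1997, Def. 3.2] -/
def _root_.Literature.Computability.Cryptography.QGate.queryWeights (D : Set (List Bool)) : Cryptography.QGate G N → (Cryptography.QReg N → ℂ) → List ℝ
  | .gate _ _, _ => []
  | .oracle _ e, ψ => [queryWeight D e ψ]

/-- The query magnitudes `q_D(|φ_t⟩)` of `D` at the successive oracle gates of the gate list `gs`
run under the oracle `A` from the state `ψ` (`|φ_t⟩` the state just before the `t`-th oracle
gate), in order. [cite: BennettBernsteinBrassardVazirani1997, Def. 3.2] -/
def queryWeights (A : Language Bool) (D : Set (List Bool)) :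
    List (Cryptography.QGate G N) → (Cryptography.QReg N → ℂ) → List ℝ
  | [], _ => []
  | g :: gs, ψ => g.queryWeights D ψ ++ queryWeights A D gs (g.toMatrix A *ᵥ ψ)

/-- There is one query magnitude per oracle gate. [folklore] -/
theorem length_queryWeights (A : Language Bool) (D : Set (List Bool)) :
    ∀ (gs : List (Cryptography.QGate G N)) (ψ : Cryptography.QReg N → ℂ),
      (queryWeights A D gs ψ).length = (⟨gs⟩ : Cryptography.QCircuit G N).oracleQueries
  | [], _ => rfl
  | g :: gs, ψ => by
    have ih := length_queryWeights A D gs (g.toMatrix A *ᵥ ψ)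
    unfold Cryptography.QCircuit.oracleQueries at ih ⊢
    cases g with
    | gate g e =>
      simp only [queryWeights, Cryptography.QGate.queryWeights, List.nil_append]
      rw [List.filter_cons_of_neg (by simp [Cryptography.QGate.IsOracleFree])]
      exact ih
    | oracle k e =>
      simp only [queryWeights, Cryptography.QGate.queryWeights, List.singleton_append, List.length_cons]
      rw [List.filter_cons_of_pos (by simp [Cryptography.QGate.IsOracleFree]), List.length_cons, ih]

/-- Query magnitudes are nonnegative. [folklore] -/
theorem queryWeights_nonneg (A : Language Bool) (D : Set (List Bool)) :
    ∀ (gs : List (Cryptography.QGate G N)) (ψ : Cryptography.QReg N → ℂ), ∀ q ∈ queryWeights A D gs ψ, 0 ≤ q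
  | [], _ => by simp [queryWeights]
  | g :: gs, ψ => by
    intro q hq
    simp only [queryWeights, List.mem_append] at hq
    rcases hq with hq | hq
    · cases g with
      | gate g e => simp [Cryptography.QGate.queryWeights] at hq
      | oracle k e =>
        simp only [Cryptography.QGate.queryWeights, List.mem_singleton] at hq
        rw [hq]
        exact queryWeight_nonneg _ _ _
    · exact queryWeights_nonneg A D gs _ q hq

/-- The error of one gate: zero for a gate symbol, `≤ 2 √(q_D(ψ))` for an oracle gate
(`normSq_oracleGate_sub_mulVec_le`). [cite: BennettBernsteinBrassardVazirani1997, Thm. 3.3 (proof)] -/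
theorem l2Norm_gate_sub_le {A B : Language Bool} {D : Set (List Bool)}
    (hAB : ∀ w, w ∉ D → (w ∈ A ↔ w ∈ B)) (g : Cryptography.QGate G N) (ψ : Cryptography.QReg N → ℂ) :
    l2Norm (g.toMatrix B *ᵥ ψ - g.toMatrix A *ᵥ ψ) ≤
      ((g.queryWeights D ψ).map fun q => 2 * Real.sqrt q).sum := by
  cases g with
  | gate g e => simp [Cryptography.QGate.queryWeights]
  | oracle k e =>
    simp only [Cryptography.QGate.queryWeights, List.map_cons, List.map_nil, List.sum_cons, List.sum_nil,
      add_zero, Cryptography.QGate.toMatrix_oracle]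
    rw [← Matrix.sub_mulVec]
    refine l2Norm_le_of_normSq_le (by positivity) ?_
    rw [mul_pow, Real.sq_sqrt (queryWeight_nonneg _ _ _)]
    norm_num
    exact normSq_oracleGate_sub_mulVec_le hAB e ψ

/-- **BBBV's hybrid bound** (Thm. 3.3, for an oracle modified on a set `D` of strings): over a
unitary gate set, if `A` and `B` agree outside `D` then
`‖U^B_C ψ − U^A_C ψ‖₂ ≤ ∑_t 2 √(q_D(|φ_t⟩))`, the sum over the oracle gates of the circuit, where
`|φ_t⟩` is the state of the `A`-run before the `t`-th oracle gate: writing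
`|φ_T⟩ − |φ'_T⟩ = ∑_t U'_{T-1} ⋯ U'_{t+1} |E_t⟩` with `|E_t⟩ = (U'_t − U_t)|φ_t⟩`, unitarity gives
`‖U' ⋯ |E_t⟩‖ = ‖E_t‖ ≤ 2 √(q_D(|φ_t⟩))`. [cite: BennettBernsteinBrassardVazirani1997, Thm. 3.3] -/
theorem l2Norm_toMatrix_sub_le (hG : G.IsUnitary) {A B : Language Bool} {D : Set (List Bool)}
    (hAB : ∀ w, w ∉ D → (w ∈ A ↔ w ∈ B)) :
    ∀ (gs : List (Cryptography.QGate G N)) (ψ : Cryptography.QReg N → ℂ),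
      l2Norm ((⟨gs⟩ : Cryptography.QCircuit G N).toMatrix B *ᵥ ψ - (⟨gs⟩ : Cryptography.QCircuit G N).toMatrix A *ᵥ ψ) ≤
        ((queryWeights A D gs ψ).map fun q => 2 * Real.sqrt q).sum
  | [], ψ => by simp [queryWeights]
  | g :: gs, ψ => by
    have ih := l2Norm_toMatrix_sub_le hG hAB gs (g.toMatrix A *ᵥ ψ)
    rw [Cryptography.QCircuit.toMatrix_cons, Cryptography.QCircuit.toMatrix_cons, ← Matrix.mulVec_mulVec,
      ← Matrix.mulVec_mulVec]
    simp only [queryWeights, List.map_append, List.sum_append]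
    refine (l2Norm_sub_le _ ((⟨gs⟩ : Cryptography.QCircuit G N).toMatrix B *ᵥ (g.toMatrix A *ᵥ ψ)) _).trans
      (add_le_add ?_ ih)
    rw [← Matrix.mulVec_sub,
      l2Norm_mulVec_of_mem_unitaryGroup (Cryptography.QCircuit.toMatrix_mem_unitaryGroup_holds hG B ⟨gs⟩)]
    exact l2Norm_gate_sub_le hAB g ψ

/-! ### Cauchy–Schwarz: `∑_t √q_t ≤ √(T · ∑_t q_t)` -/

/-- `(∑_{q ∈ l} √q)² ≤ |l| · ∑_{q ∈ l} q` for nonnegative reals (Cauchy–Schwarz, by induction with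
AM–GM). [cite: BennettBernsteinBrassardVazirani1997, Thm. 3.3 (proof: "the squared magnitude of their sum is at most T times the sum of their squared magnitudes")] -/
theorem sq_sum_sqrt_le : ∀ (l : List ℝ), (∀ q ∈ l, 0 ≤ q) →
    (l.map Real.sqrt).sum ^ 2 ≤ l.length * l.sum
  | [], _ => by simp
  | a :: l, hl => by
    have ha : 0 ≤ a := hl a (by simp)
    have hl' : ∀ q ∈ l, 0 ≤ q := fun q hq => hl q (by simp [hq])
    have ih := sq_sum_sqrt_le l hl'
    have hS : 0 ≤ l.sum := List.sum_nonneg hl'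
    have hs : 0 ≤ (l.map Real.sqrt).sum :=
      List.sum_nonneg fun q hq => by
        obtain ⟨r, -, rfl⟩ := List.mem_map.1 hq
        exact Real.sqrt_nonneg r
    set s := (l.map Real.sqrt).sum with hs_def
    set S := l.sum
    set m : ℝ := (l.length : ℝ) with hm_def
    have hm : 0 ≤ m := by positivity
    simp only [List.map_cons, List.sum_cons, List.length_cons, Nat.cast_succ]
    -- (√a + s)² ≤ (m + 1) (a + S)
    have h1 : s ≤ Real.sqrt (m * S) := (Real.le_sqrt hs (by positivity)).2 ih
    have h2 : 2 * Real.sqrt (m * a) * Real.sqrt S ≤ m * a + S := by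
      nlinarith [sq_nonneg (Real.sqrt (m * a) - Real.sqrt S), Real.sq_sqrt (show 0 ≤ m * a by positivity),
        Real.sq_sqrt hS]
    have h3 : Real.sqrt a * s ≤ Real.sqrt a * Real.sqrt (m * S) :=
      mul_le_mul_of_nonneg_left h1 (Real.sqrt_nonneg a)
    have h4 : Real.sqrt a * Real.sqrt (m * S) = Real.sqrt (m * a) * Real.sqrt S := by
      rw [← Real.sqrt_mul ha, ← Real.sqrt_mul (by positivity : 0 ≤ m * a)]
      ring_nf
    nlinarith [Real.sq_sqrt ha, h3, h4, h2, ih, Real.sqrt_nonneg a]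

/-- `∑_{q ∈ l} 2√q ≤ 2 √(|l| · ∑ l)` for nonnegative reals. [folklore] -/
theorem sum_map_two_mul_sqrt_le (l : List ℝ) (hl : ∀ q ∈ l, 0 ≤ q) :
    (l.map fun q => 2 * Real.sqrt q).sum ≤ 2 * Real.sqrt (l.length * l.sum) := by
  rw [List.sum_map_mul_left]
  refine mul_le_mul_of_nonneg_left ?_ (by norm_num)
  refine (Real.le_sqrt ?_ ?_).2 (sq_sum_sqrt_le l hl)
  · exact List.sum_nonneg fun q hq => by
      obtain ⟨r, -, rfl⟩ := List.mem_map.1 hq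
      exact Real.sqrt_nonneg r
  · exact mul_nonneg (by positivity) (List.sum_nonneg hl)

/-! ### Counting the heavily queried strings (BBBV 1997, Cor. 3.4) -/

/-- Distinct strings have disjoint query events: `∑_{y ∈ Y} q_{{y}}(ψ) ≤ normSq ψ`.
[cite: BennettBernsteinBrassardVazirani1997, Cor. 3.4 (proof)] -/
theorem sum_queryWeight_singleton_le (Y : Finset (List Bool)) (e : Fin (k + 1) ↪ Fin N)
    (ψ : Cryptography.QReg N → ℂ) : ∑ y ∈ Y, queryWeight ({y} : Set (List Bool)) e ψ ≤ Cryptography.normSq ψ := by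
  classical
  unfold queryWeight Cryptography.normSq
  rw [Finset.sum_comm]
  refine Finset.sum_le_sum fun x _ => ?_
  simp only [Set.mem_singleton_iff]
  rw [Finset.sum_ite_eq]
  split_ifs
  · exact le_rfl
  · positivity

/-- **Total query magnitude** (BBBV 1997, proof of Cor. 3.4: "since each `|φ_t⟩` has unit length,
`∑_t ∑_y q_y(|φ_t⟩) ≤ T`"): over a unitary gate set,
`∑_{y ∈ Y} ∑_t q_y(|φ_t⟩) ≤ T · normSq ψ` with `T` the number of oracle gates.
[cite: BennettBernsteinBrassardVazirani1997, Cor. 3.4 (proof)] -/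
theorem sum_sum_queryWeights_le (hG : G.IsUnitary) (A : Language Bool) (Y : Finset (List Bool)) :
    ∀ (gs : List (Cryptography.QGate G N)) (ψ : Cryptography.QReg N → ℂ),
      ∑ y ∈ Y, (queryWeights A ({y} : Set (List Bool)) gs ψ).sum ≤
        (⟨gs⟩ : Cryptography.QCircuit G N).oracleQueries * Cryptography.normSq ψ
  | [], ψ => by simp [queryWeights, Cryptography.QCircuit.oracleQueries]
  | g :: gs, ψ => by
    have ih := sum_sum_queryWeights_le hG A Y gs (g.toMatrix A *ᵥ ψ)
    rw [Cryptography.normSq_mulVec_of_mem_unitaryGroup (Cryptography.QGate.toMatrix_mem_unitaryGroup_holds hG A g)] at ih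
    simp only [queryWeights, List.sum_append, Finset.sum_add_distrib]
    cases g with
    | gate g e =>
      have hq : (⟨Cryptography.QGate.gate g e :: gs⟩ : Cryptography.QCircuit G N).oracleQueries =
          (⟨gs⟩ : Cryptography.QCircuit G N).oracleQueries := by
        unfold Cryptography.QCircuit.oracleQueries
        rw [List.filter_cons_of_neg (by simp [Cryptography.QGate.IsOracleFree])]
      simp only [Cryptography.QGate.queryWeights, List.sum_nil, Finset.sum_const_zero, zero_add, hq]
      exact ih
    | oracle k e =>
      have hq : (⟨Cryptography.QGate.oracle k e :: gs⟩ : Cryptography.QCircuit G N).oracleQueries =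
          (⟨gs⟩ : Cryptography.QCircuit G N).oracleQueries + 1 := by
        unfold Cryptography.QCircuit.oracleQueries
        rw [List.filter_cons_of_pos (by simp [Cryptography.QGate.IsOracleFree]), List.length_cons]
      simp only [Cryptography.QGate.queryWeights, List.sum_cons, List.sum_nil, add_zero, hq, Nat.cast_succ]
      have h1 := sum_queryWeight_singleton_le Y e ψ
      linarith

/-- A string at least as long as the register is never queried: `q_{{y}} = 0` if `N ≤ |y|` (the
query register of an oracle gate on `N` wires has fewer than `N` wires). [folklore] -/
theorem queryWeight_singleton_eq_zero_of_le_length (e : Fin (k + 1) ↪ Fin N) (ψ : Cryptography.QReg N → ℂ)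
    {y : List Bool} (hy : N ≤ y.length) : queryWeight ({y} : Set (List Bool)) e ψ = 0 := by
  classical
  unfold queryWeight
  refine Finset.sum_eq_zero fun x _ => ?_
  rw [if_neg]
  simp only [Set.mem_singleton_iff]
  intro h
  have hk : k + 1 ≤ N := by simpa using Fintype.card_le_of_embedding e
  have hlen : (Cryptography.queryOf e x).length = k := by simp [Cryptography.queryOf]
  rw [h] at hlen
  omega

/-- Hence the total query magnitude of such a string vanishes. [folklore] -/
theorem sum_queryWeights_eq_zero_of_le_length (A : Language Bool) {y : List Bool}
    (hy : N ≤ y.length) :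
    ∀ (gs : List (Cryptography.QGate G N)) (ψ : Cryptography.QReg N → ℂ),
      (queryWeights A ({y} : Set (List Bool)) gs ψ).sum = 0
  | [], _ => rfl
  | g :: gs, ψ => by
    simp only [queryWeights, List.sum_append, sum_queryWeights_eq_zero_of_le_length A hy gs,
      add_zero]
    cases g with
    | gate g e => rfl
    | oracle k e => simp [Cryptography.QGate.queryWeights, queryWeight_singleton_eq_zero_of_le_length e ψ hy]

/-- **BBBV, Cor. 3.4 / Fortnow–Rogers Thm. 4.3 (state-vector form).** Over a unitary gate set, for
a circuit `C` with `T` oracle gates run on a unit vector `ψ` with oracle `A`, and `ε > 0`, there is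
a set `S` of strings with `|S| ≤ 4T²/ε²` such that for every oracle `B` differing from `A` only on
a single string `y ∉ S`, `‖U^B_C ψ − U^A_C ψ‖₂ ≤ ε`. (`S` = the strings of total query magnitude
`≥ ε²/4T`; BBBV state the Euclidean bound with `|S| ≤ 2T²/ε²` in their machine model, the XOR
query gate costs the factor `4` of `normSq_oracleGate_sub_mulVec_le`.)
[cite: BennettBernsteinBrassardVazirani1997, Cor. 3.4] [cite: FortnowRogers1999JCSS, Thm. 4.3 (arXiv numbering)] -/
theorem exists_finset_l2Norm_runOn_sub_le (hG : G.IsUnitary) (C : Cryptography.QCircuit G N)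
    (A : Language Bool) (ψ : Cryptography.QReg N → ℂ) (hψ : Cryptography.normSq ψ = 1) {ε : ℝ} (hε : 0 < ε) :
    ∃ S : Finset (List Bool), (S.card : ℝ) ≤ 4 * (C.oracleQueries : ℝ) ^ 2 / ε ^ 2 ∧
      ∀ (B : Language Bool) (y : List Bool), y ∉ S → (∀ w, w ≠ y → (w ∈ A ↔ w ∈ B)) →
        l2Norm (C.runOn B ψ - C.runOn A ψ) ≤ ε := by
  classical
  obtain ⟨gs⟩ := C
  set T : ℕ := (⟨gs⟩ : Cryptography.QCircuit G N).oracleQueries with hT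
  set Q : List Bool → ℝ := fun y => (queryWeights A ({y} : Set (List Bool)) gs ψ).sum with hQ
  have hQnn : ∀ y, 0 ≤ Q y := fun y => List.sum_nonneg (queryWeights_nonneg A {y} gs ψ)
  have hbound : ∀ (B : Language Bool) (y : List Bool), (∀ w, w ≠ y → (w ∈ A ↔ w ∈ B)) →
      l2Norm ((⟨gs⟩ : Cryptography.QCircuit G N).runOn B ψ - (⟨gs⟩ : Cryptography.QCircuit G N).runOn A ψ) ≤
        2 * Real.sqrt (T * Q y) := by
    intro B y hy
    have hAB : ∀ w, w ∉ ({y} : Set (List Bool)) → (w ∈ A ↔ w ∈ B) := fun w hw =>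
      hy w (by simpa using hw)
    refine (l2Norm_toMatrix_sub_le hG hAB gs ψ).trans ?_
    have h := sum_map_two_mul_sqrt_le (queryWeights A {y} gs ψ) (queryWeights_nonneg A {y} gs ψ)
    rwa [length_queryWeights] at h
  by_cases hT0 : T = 0
  · refine ⟨∅, by simp; positivity, fun B y _ hy => (hbound B y hy).trans ?_⟩
    rw [hT0, Nat.cast_zero, zero_mul, Real.sqrt_zero, mul_zero]
    exact hε.le
  have hTpos : (0 : ℝ) < T := by exact_mod_cast Nat.pos_of_ne_zero hT0
  set θ : ℝ := ε ^ 2 / (4 * T) with hθ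
  have hθpos : 0 < θ := by positivity
  have hTθ : (T : ℝ) * θ = (ε / 2) ^ 2 := by
    rw [hθ]
    field_simp
    ring
  set Y : Finset (List Bool) := (List.finite_length_lt Bool N).toFinset with hY
  refine ⟨Y.filter (fun y => θ ≤ Q y), ?_, ?_⟩
  · have h1 : ((Y.filter fun y => θ ≤ Q y).card : ℝ) * θ ≤
        ∑ y ∈ Y.filter (fun y => θ ≤ Q y), Q y := by
      rw [← nsmul_eq_mul, ← Finset.sum_const]
      exact Finset.sum_le_sum fun y hy => (Finset.mem_filter.1 hy).2
    have h2 : ∑ y ∈ Y.filter (fun y => θ ≤ Q y), Q y ≤ ∑ y ∈ Y, Q y :=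
      Finset.sum_le_sum_of_subset_of_nonneg (Finset.filter_subset _ _) fun y _ _ => hQnn y
    have h3 : ∑ y ∈ Y, Q y ≤ T * Cryptography.normSq ψ := sum_sum_queryWeights_le hG A Y gs ψ
    rw [hψ, mul_one] at h3
    have h4 : ((Y.filter fun y => θ ≤ Q y).card : ℝ) * θ ≤ T := h1.trans (h2.trans h3)
    rw [le_div_iff₀ (by positivity)]
    calc ((Y.filter fun y => θ ≤ Q y).card : ℝ) * ε ^ 2
        = ((Y.filter fun y => θ ≤ Q y).card : ℝ) * θ * (4 * T) := by
          rw [hθ]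
          field_simp
      _ ≤ T * (4 * T) := by gcongr
      _ = 4 * (T : ℝ) ^ 2 := by ring
  · intro B y hyS hy
    refine (hbound B y hy).trans ?_
    have hQy : Q y ≤ θ := by
      by_cases hyY : y ∈ Y
      · by_contra h
        exact hyS (Finset.mem_filter.2 ⟨hyY, (not_le.1 h).le⟩)
      · have hlen : N ≤ y.length := by
          by_contra hlt
          exact hyY (by rw [hY, Set.Finite.mem_toFinset]; exact not_le.1 hlt)
        rw [show Q y = 0 from sum_queryWeights_eq_zero_of_le_length A hlen gs ψ]
        exact hθpos.le
    calc 2 * Real.sqrt (T * Q y) ≤ 2 * Real.sqrt (T * θ) := by gcongr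
      _ = ε := by
        rw [hTθ, Real.sqrt_sq (by positivity)]
        ring

/-! ### From state vectors to outcome probabilities (BBBV 1997, Thm. 3.1) -/

/-- Cauchy–Schwarz with square roots: `∑ f g ≤ √(∑ f²) · √(∑ g²)`. [folklore] -/
theorem sum_mul_le_sqrt_mul_sqrt {ι : Type*} (s : Finset ι) (f g : ι → ℝ) :
    ∑ i ∈ s, f i * g i ≤ Real.sqrt (∑ i ∈ s, f i ^ 2) * Real.sqrt (∑ i ∈ s, g i ^ 2) := by
  rw [← Real.sqrt_mul (Finset.sum_nonneg fun i _ => sq_nonneg (f i))]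
  exact (le_abs_self _).trans (Real.abs_le_sqrt (Finset.sum_mul_sq_le_sq_mul_sq s f g))

/-- A signed sum with zero total is at most half its absolute sum on any event:
`|∑_{x ∈ E} d x| ≤ ½ ∑ₓ |d x|` when `∑ₓ d x = 0`. [folklore] -/
theorem abs_sum_le_half_sum_abs {ι : Type*} [Fintype ι] [DecidableEq ι] (E : Finset ι)
    (d : ι → ℝ) (hd : ∑ x, d x = 0) : |∑ x ∈ E, d x| ≤ (1 / 2) * ∑ x, |d x| := by
  have hsplit : ∑ x ∈ E, d x + ∑ x ∈ Eᶜ, d x = 0 := by rw [Finset.sum_add_sum_compl, hd]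
  have habs : ∑ x ∈ E, |d x| + ∑ x ∈ Eᶜ, |d x| = ∑ x, |d x| := Finset.sum_add_sum_compl _ _
  have h1 : |∑ x ∈ E, d x| ≤ ∑ x ∈ E, |d x| := Finset.abs_sum_le_sum_abs _ _
  have h2 : |∑ x ∈ Eᶜ, d x| ≤ ∑ x ∈ Eᶜ, |d x| := Finset.abs_sum_le_sum_abs _ _
  have h3 : |∑ x ∈ E, d x| = |∑ x ∈ Eᶜ, d x| := by
    rw [show ∑ x ∈ E, d x = -∑ x ∈ Eᶜ, d x by linarith, abs_neg]
  linarith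

/-- **Close unit vectors give close outcome statistics** (BBBV 1997, Thm. 3.1, from
Bernstein–Vazirani; here for a single event): if `a`, `b` are unit vectors then for every event
`E`, `|∑_{x ∈ E} |a x|² − ∑_{x ∈ E} |b x|²| ≤ ‖a − b‖₂`. (The absolute sum
`∑ₓ | |a x|² − |b x|² | ≤ ∑ₓ |a x − b x| (|a x| + |b x|) ≤ 2‖a − b‖₂` by Cauchy–Schwarz, and an event
carries at most half of a zero-sum signed measure.) [cite: BennettBernsteinBrassardVazirani1997, Thm. 3.1] -/
theorem abs_sum_normSq_sub_le {a b : Cryptography.QReg N → ℂ} (ha : Cryptography.normSq a = 1) (hb : Cryptography.normSq b = 1)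
    (E : Finset (Cryptography.QReg N)) :
    |∑ x ∈ E, ‖a x‖ ^ 2 - ∑ x ∈ E, ‖b x‖ ^ 2| ≤ l2Norm (a - b) := by
  classical
  have hsum : ∑ x, (‖a x‖ ^ 2 - ‖b x‖ ^ 2) = 0 := by
    rw [Finset.sum_sub_distrib]
    change Cryptography.normSq a - Cryptography.normSq b = 0
    rw [ha, hb, sub_self]
  have h1 := abs_sum_le_half_sum_abs E (fun x => ‖a x‖ ^ 2 - ‖b x‖ ^ 2) hsum
  rw [← Finset.sum_sub_distrib]
  refine h1.trans ?_
  -- ∑ |‖a‖² − ‖b‖²| ≤ 2 ‖a − b‖₂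
  have hterm : ∀ x, |‖a x‖ ^ 2 - ‖b x‖ ^ 2| ≤ ‖a x - b x‖ * ‖a x‖ + ‖a x - b x‖ * ‖b x‖ := by
    intro x
    rw [sq_sub_sq, abs_mul, abs_of_nonneg (by positivity : 0 ≤ ‖a x‖ + ‖b x‖)]
    have h : |‖a x‖ - ‖b x‖| ≤ ‖a x - b x‖ := abs_norm_sub_norm_le _ _
    nlinarith [norm_nonneg (a x), norm_nonneg (b x), abs_nonneg (‖a x‖ - ‖b x‖)]
  have hA : ∑ x, ‖a x - b x‖ * ‖a x‖ ≤ l2Norm (a - b) * 1 := by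
    refine (sum_mul_le_sqrt_mul_sqrt _ _ _).trans (le_of_eq ?_)
    rw [l2Norm_eq_sqrt_normSq, ← Real.sqrt_one]
    congr 1
    rw [← ha]
    rfl
  have hB : ∑ x, ‖a x - b x‖ * ‖b x‖ ≤ l2Norm (a - b) * 1 := by
    refine (sum_mul_le_sqrt_mul_sqrt _ _ _).trans (le_of_eq ?_)
    rw [l2Norm_eq_sqrt_normSq, ← Real.sqrt_one]
    congr 1
    rw [← hb]
    rfl
  have hS : ∑ x, |‖a x‖ ^ 2 - ‖b x‖ ^ 2| ≤ 2 * l2Norm (a - b) := by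
    calc ∑ x, |‖a x‖ ^ 2 - ‖b x‖ ^ 2|
        ≤ ∑ x, (‖a x - b x‖ * ‖a x‖ + ‖a x - b x‖ * ‖b x‖) := Finset.sum_le_sum fun x _ => hterm x
      _ = ∑ x, ‖a x - b x‖ * ‖a x‖ + ∑ x, ‖a x - b x‖ * ‖b x‖ := Finset.sum_add_distrib
      _ ≤ 2 * l2Norm (a - b) := by linarith
  linarith

/-- **Acceptance probabilities move by at most the `ℓ²`-distance of the output states** (over a
unitary gate set). [cite: BennettBernsteinBrassardVazirani1997, Thm. 3.1] -/
theorem _root_.Literature.Computability.Cryptography.QCircuit.abs_acceptProb_sub_le (hG : G.IsUnitary) {n m : ℕ} (C : Cryptography.QCircuit G (n + m))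
    (A B : Language Bool) (x : Cryptography.QReg n) :
    |C.acceptProb B x - C.acceptProb A x| ≤
      l2Norm (C.runOn B (Cryptography.basisState (Cryptography.padInput x m)) - C.runOn A (Cryptography.basisState (Cryptography.padInput x m))) := by
  classical
  by_cases h : 0 < n + m
  · have key : ∀ X : Language Bool, C.acceptProb X x =
        ∑ y ∈ Finset.univ.filter (fun y : Cryptography.QReg (n + m) => y ⟨0, h⟩ = true),
          ‖(C.runOn X (Cryptography.basisState (Cryptography.padInput x m))) y‖ ^ 2 := fun X => by
      rw [Cryptography.QCircuit.acceptProb, Finset.sum_filter]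
      refine Finset.sum_congr rfl fun y _ => ?_
      rw [dif_pos h]
    rw [key, key]
    exact abs_sum_normSq_sub_le (Cryptography.QCircuit.normSq_runOn_basisState hG B C x)
      (Cryptography.QCircuit.normSq_runOn_basisState hG A C x) _
  · have key : ∀ X : Language Bool, C.acceptProb X x = 0 := fun X => by
      rw [Cryptography.QCircuit.acceptProb]
      exact Finset.sum_eq_zero fun y _ => by rw [dif_neg h]
    rw [key, key, sub_self, abs_zero]
    exact l2Norm_nonneg _

/-! ### Fortnow–Rogers' Theorem 4.3 for uniform-circuit `BQP^O` machines -/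

/-- **BBBV Cor. 3.4 / Fortnow–Rogers Thm. 4.3 for circuit families over a unitary gate set.** For a
family `F`, an oracle `A` and an input `x`, let `T` be the number of oracle gates of the circuit
`F.circ |x|`; for every `ε > 0` there is a set `S` of strings, `|S| ≤ 4T²/ε²`, such that for every
oracle `B` that differs from `A` only on a single string outside `S`,
`|Pr[F^B accepts x] − Pr[F^A accepts x]| ≤ ε`. Fortnow–Rogers: "Let `M` be an oracle BQP machine
that runs in time `p(n)` and let `O` be an oracle and `x` an `n`-bit input. There is a set `S` such
that for all oracles `O'`, if `O'` differs from `O` only on a single string and that string is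
not in `S` then `|P[M^{O'} accepts x] − P[M^{O} accepts x]| ≤ ε`, where `|S| ≤ 4p²(n)/ε²`"; in the
tree's model of `BQP^O` (`BQPRel`: uniform circuit families with XOR-query gates) the running time
`p(n)` bounds the number `T` of oracle gates. [cite: FortnowRogers1999JCSS, Thm. 4.3 (arXiv numbering)] [cite: BennettBernsteinBrassardVazirani1997, Cor. 3.4] -/
theorem _root_.Literature.Computability.Cryptography.QCircuitFamily.exists_finset_abs_acceptProbOn_sub_le (hG : G.IsUnitary)
    (F : Cryptography.QCircuitFamily G) (A : Language Bool) (x : List Bool) {ε : ℝ} (hε : 0 < ε) :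
    ∃ S : Finset (List Bool),
      (S.card : ℝ) ≤ 4 * ((F.circ x.length).oracleQueries : ℝ) ^ 2 / ε ^ 2 ∧
      ∀ (B : Language Bool) (y : List Bool), y ∉ S → (∀ w, w ≠ y → (w ∈ A ↔ w ∈ B)) →
        |F.acceptProbOn B x - F.acceptProbOn A x| ≤ ε := by
  obtain ⟨S, hS, h⟩ := exists_finset_l2Norm_runOn_sub_le hG (F.circ x.length) A
    (Cryptography.basisState (Cryptography.padInput x.get (F.ancillas x.length))) (Cryptography.normSq_basisState _) hε
  refine ⟨S, hS, fun B y hyS hy => ?_⟩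
  exact (Cryptography.QCircuit.abs_acceptProb_sub_le hG (F.circ x.length) A B x.get).trans (h B y hyS hy)

/-- **Fortnow–Rogers 1999, Thm. 4.3** (the BBBV bound) for the tree's `BQP^O` machines: Clifford+T
circuit families with XOR-query oracle gates (`cliffordT_isUnitary_holds`).
[cite: FortnowRogers1999JCSS, Thm. 4.3 (arXiv numbering)] [cite: BennettBernsteinBrassardVazirani1997, Thm. 3.3 and Cor. 3.4] -/
theorem fortnowRogers1999_thm43 (F : Cryptography.QCircuitFamily Cryptography.cliffordT) (A : Language Bool) (x : List Bool)
    {ε : ℝ} (hε : 0 < ε) :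
    ∃ S : Finset (List Bool),
      (S.card : ℝ) ≤ 4 * ((F.circ x.length).oracleQueries : ℝ) ^ 2 / ε ^ 2 ∧
      ∀ (B : Language Bool) (y : List Bool), y ∉ S → (∀ w, w ≠ y → (w ∈ A ↔ w ∈ B)) →
        |F.acceptProbOn B x - F.acceptProbOn A x| ≤ ε :=
  F.exists_finset_abs_acceptProbOn_sub_le Cryptography.cliffordT_isUnitary_holds A x hε

end Literature.Computability.QuantumComplexity

end
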